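import Mathlib.Analysis.Calculus.ContDiff.RCLike
import Mathlib.Analysis.Calculus.ContDiff.FiniteDimension
import Mathlib.Analysis.Calculus.MeanValue
import Mathlib.Analysis.Calculus.Deriv.Pow
import Mathlib.Analysis.MeanInequalitiesPow
import Mathlib.Algebra.BigOperators.Pi
import Mathlib.Algebra.Order.Chebyshev
import HarnessLib

/-!
# Route `ColdStartUniversality`, rung `stub_fixedCutoffMixing` of K_A1 (stmt-QuantumFields-24809):
# second-order Taylor data of a `C³` function with compact support

Helper file (seat `ym-line-csu-p1`, g6).  The Dynkin formula in expectation
(`dynkin_expectation`, `…LatticeLangevinDynkin`) takes its test function through TAYLOR DATA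
`(f, g, h, Cf)`: `gᵢ, hᵢⱼ` continuous, all bounded by `Cf`, `Cf`-Lipschitz for the `ℓ¹` distance, and
`|f(y+Δ) - f(y) - ∑ gᵢ(y)Δᵢ - ½ ∑ hᵢⱼ(y)ΔᵢΔⱼ| ≤ Cf ∑ |Δᵢ|³`.  This file produces such data from a
`C³` function with compact support on `ι → ℝ` (`taylorData_of_contDiff`), with
`gᵢ = ∂ᵢf := Df(·)(eᵢ)` and `hᵢⱼ = ∂ⱼ∂ᵢf`, by the mean value inequality along segments.
Pure calculus; no definition, no sorry, standard axioms.  RECORD-rung plumbing (R3); the Yang–Mills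
mass gap is NOT proved.
-/

set_option autoImplicit false

noncomputable section

namespace Summit.QuantumFields.YangMills.Theorems.ColdStartUniversality

open Filter Finset Set
open scoped Topology

section Calculus

variable {ι : Type} [Fintype ι]

/-- A linear functional on `ι → ℝ` evaluated through the coordinate vectors:
`A Δ = ∑ᵢ Δᵢ A(eᵢ)`. [folklore] -/
theorem clm_apply_eq_sum [DecidableEq ι] (A : (ι → ℝ) →L[ℝ] ℝ) (Δ : ι → ℝ) :
    A Δ = ∑ i, Δ i * A (Pi.single i 1) := by
  conv_lhs => rw [pi_eq_sum_univ' Δ]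
  rw [map_sum]
  exact sum_congr rfl fun i _ ↦ by rw [map_smul, smul_eq_mul]

/-- The sup norm on `ι → ℝ` is bounded by the `ℓ¹` norm. [folklore] -/
theorem pi_norm_le_sum_abs (x : ι → ℝ) : ‖x‖ ≤ ∑ l, |x l| := by
  refine (pi_norm_le_iff_of_nonneg (sum_nonneg fun l _ ↦ abs_nonneg _)).2 fun l ↦ ?_
  rw [Real.norm_eq_abs]
  exact single_le_sum (f := fun l ↦ |x l|) (fun l _ ↦ abs_nonneg _) (mem_univ l)

/-- `(∑ aᵢ)³ ≤ n² ∑ aᵢ³` for `aᵢ ≥ 0`. [folklore] -/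
theorem pow_three_sum_le (a : ι → ℝ) (ha : ∀ i, 0 ≤ a i) :
    (∑ i, a i) ^ 3 ≤ (Fintype.card ι : ℝ) ^ 2 * ∑ i, a i ^ 3 := by
  rcases isEmpty_or_nonempty ι with hι | hι
  · simp
  have hn : (0 : ℝ) < Fintype.card ι := by exact_mod_cast Fintype.card_pos
  have h := Real.pow_arith_mean_le_arith_mean_pow (univ : Finset ι) (fun _ ↦ (Fintype.card ι : ℝ)⁻¹) a
    (fun _ _ ↦ by positivity) (by rw [sum_const, card_univ, nsmul_eq_mul, mul_inv_cancel₀ hn.ne'])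
    (fun i _ ↦ ha i) 3
  rw [← mul_sum, ← mul_sum, mul_pow] at h
  have hn3 : (0 : ℝ) < (Fintype.card ι : ℝ) ^ 3 := by positivity
  have h2 := mul_le_mul_of_nonneg_left h hn3.le
  calc (∑ i, a i) ^ 3 = (Fintype.card ι : ℝ) ^ 3 * (((Fintype.card ι : ℝ)⁻¹) ^ 3 * (∑ i, a i) ^ 3) := by
        field_simp
    _ ≤ (Fintype.card ι : ℝ) ^ 3 * ((Fintype.card ι : ℝ)⁻¹ * ∑ i, a i ^ 3) := h2
    _ = (Fintype.card ι : ℝ) ^ 2 * ∑ i, a i ^ 3 := by field_simp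

/-- **Second-order Taylor estimate along a segment.**  For `f : (ι → ℝ) → ℝ` of class `C²` with
`gᵢ = ∂ᵢ f`, `hᵢⱼ = ∂ⱼ∂ᵢ f` and `hᵢⱼ` Lipschitz (`|hᵢⱼ y - hᵢⱼ y'| ≤ L ∑ₗ |yₗ - y'ₗ|`):
`|f(y+Δ) - f(y) - ∑ gᵢ(y)Δᵢ - ½∑ hᵢⱼ(y)ΔᵢΔⱼ| ≤ L (∑|Δᵢ|)³` (mean value inequality applied twice to
`τ ↦ f(y + τΔ)`). [folklore] -/
theorem abs_taylor_two_sub_le_of_lipschitz [DecidableEq ι] {f : (ι → ℝ) → ℝ} (hf : ContDiff ℝ 2 f)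
    {L : ℝ} (hL : 0 ≤ L)
    (hhL : ∀ i j y y', |fderiv ℝ (fun z ↦ fderiv ℝ f z (Pi.single i 1)) y (Pi.single j 1) -
      fderiv ℝ (fun z ↦ fderiv ℝ f z (Pi.single i 1)) y' (Pi.single j 1)| ≤ L * ∑ l, |y l - y' l|)
    (y Δ : ι → ℝ) :
    |f (y + Δ) - f y - ∑ i, fderiv ℝ f y (Pi.single i 1) * Δ i -
      (1 / 2) * ∑ i, ∑ j, fderiv ℝ (fun z ↦ fderiv ℝ f z (Pi.single i 1)) y (Pi.single j 1) * (Δ i * Δ j)|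
      ≤ L * (∑ i, |Δ i|) ^ 3 := by
  -- notation
  set g : ι → (ι → ℝ) → ℝ := fun i z ↦ fderiv ℝ f z (Pi.single i 1) with hg
  set h : ι → ι → (ι → ℝ) → ℝ := fun i j z ↦ fderiv ℝ (g i) z (Pi.single j 1) with hh
  have hfd : Differentiable ℝ f := hf.differentiable (by norm_num)
  have hg_cd : ∀ i, ContDiff ℝ 1 (g i) := fun i ↦
    (hf.fderiv_right (by norm_num)).clm_apply contDiff_const
  have hgd : ∀ i, Differentiable ℝ (g i) := fun i ↦ (hg_cd i).differentiable (by norm_num)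
  set S : ℝ := ∑ l, |Δ l| with hS
  have hS0 : 0 ≤ S := sum_nonneg fun l _ ↦ abs_nonneg _
  -- the path and its derivatives
  set γ : ℝ → (ι → ℝ) := fun τ ↦ y + τ • Δ with hγ
  have hγd : ∀ τ, HasDerivAt γ Δ τ := fun τ ↦ by
    have := ((hasDerivAt_id τ).smul_const Δ).const_add y
    simpa [hγ] using this
  set φ₁ : ℝ → ℝ := fun τ ↦ ∑ i, Δ i * g i (γ τ) with hφ₁
  set φ₂ : ℝ → ℝ := fun τ ↦ ∑ i, Δ i * ∑ j, Δ j * h i j (γ τ) with hφ₂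
  have hφd : ∀ τ, HasDerivAt (fun τ ↦ f (γ τ)) (φ₁ τ) τ := by
    intro τ
    have h1 := (hfd (γ τ)).hasFDerivAt.comp_hasDerivAt τ (hγd τ)
    have e : fderiv ℝ f (γ τ) Δ = φ₁ τ := by
      rw [hφ₁, clm_apply_eq_sum]
    rw [← e]; exact h1
  have hφ₁d : ∀ τ, HasDerivAt φ₁ (φ₂ τ) τ := by
    intro τ
    have hterm : ∀ i, HasDerivAt (fun τ ↦ Δ i * g i (γ τ)) (Δ i * ∑ j, Δ j * h i j (γ τ)) τ := by
      intro i
      have h1 := ((hgd i) (γ τ)).hasFDerivAt.comp_hasDerivAt τ (hγd τ)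
      have e : fderiv ℝ (g i) (γ τ) Δ = ∑ j, Δ j * h i j (γ τ) := by
        rw [hh, clm_apply_eq_sum]
      rw [← e]
      exact h1.const_mul (Δ i)
    have := HasDerivAt.fun_sum (u := (univ : Finset ι)) fun i _ ↦ hterm i
    simpa [hφ₁, hφ₂] using this
  -- the Lipschitz bound on `φ₂`
  have hφ₂L : ∀ τ ∈ Icc (0 : ℝ) 1, |φ₂ τ - φ₂ 0| ≤ L * S ^ 3 := by
    intro τ hτ
    have hdist : ∑ l, |γ τ l - γ 0 l| ≤ S := by
      have e : ∀ l, γ τ l - γ 0 l = τ * Δ l := fun l ↦ by simp [hγ]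
      simp_rw [e, abs_mul, abs_of_nonneg hτ.1, ← mul_sum]
      exact mul_le_of_le_one_left hS0 hτ.2
    rw [hφ₂]
    simp only
    rw [← sum_sub_distrib]
    calc |∑ i, (Δ i * ∑ j, Δ j * h i j (γ τ) - Δ i * ∑ j, Δ j * h i j (γ 0))|
        ≤ ∑ i, |Δ i * ∑ j, Δ j * h i j (γ τ) - Δ i * ∑ j, Δ j * h i j (γ 0)| := abs_sum_le_sum_abs _ _
      _ ≤ ∑ i, |Δ i| * ∑ j, |Δ j| * (L * S) := by
          refine sum_le_sum fun i _ ↦ ?_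
          rw [← mul_sub, abs_mul, ← sum_sub_distrib]
          refine mul_le_mul_of_nonneg_left ((abs_sum_le_sum_abs _ _).trans (sum_le_sum fun j _ ↦ ?_))
            (abs_nonneg _)
          rw [← mul_sub, abs_mul]
          refine mul_le_mul_of_nonneg_left ?_ (abs_nonneg _)
          exact (hhL i j _ _).trans (mul_le_mul_of_nonneg_left hdist hL)
      _ = L * (S * S * S) := by rw [hS]; simp only [← sum_mul]; ring
      _ = L * S ^ 3 := by ring
  -- first application of the mean value inequality: `ψ₁ = φ₁ - φ₁ 0 - τ φ₂ 0`
  have hψ₁ : ∀ τ ∈ Icc (0 : ℝ) 1, |φ₁ τ - φ₁ 0 - τ * φ₂ 0| ≤ L * S ^ 3 * τ := by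
    have hder : ∀ τ ∈ Icc (0 : ℝ) 1,
        HasDerivWithinAt (fun τ ↦ φ₁ τ - φ₁ 0 - τ * φ₂ 0) (φ₂ τ - φ₂ 0) (Icc 0 1) τ := by
      intro τ _
      have hB : HasDerivAt (fun τ : ℝ ↦ τ * φ₂ 0) (φ₂ 0) τ := by
        simpa using (hasDerivAt_id τ).mul_const (φ₂ 0)
      have h1 : HasDerivAt (fun τ ↦ φ₁ τ - φ₁ 0 - τ * φ₂ 0) (φ₂ τ - φ₂ 0) τ :=
        ((hφ₁d τ).sub_const (φ₁ 0)).fun_sub hB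
      exact h1.hasDerivWithinAt
    have h := norm_image_sub_le_of_norm_deriv_le_segment' hder (fun τ hτ ↦ by
      rw [Real.norm_eq_abs]; exact hφ₂L τ (Ico_subset_Icc_self hτ))
    intro τ hτ
    have := h τ hτ
    simpa [Real.norm_eq_abs] using this
  -- second application: `ψ = f ∘ γ - f y - τ φ₁ 0 - τ²/2 φ₂ 0`
  have hψ : |f (γ 1) - f (γ 0) - φ₁ 0 - (1 / 2) * φ₂ 0| ≤ L * S ^ 3 := by
    have hder : ∀ τ ∈ Icc (0 : ℝ) 1,
        HasDerivWithinAt (fun τ ↦ f (γ τ) - f (γ 0) - τ * φ₁ 0 - (1 / 2) * τ ^ 2 * φ₂ 0)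
          (φ₁ τ - φ₁ 0 - τ * φ₂ 0) (Icc 0 1) τ := by
      intro τ _
      have hA : HasDerivAt (fun τ ↦ f (γ τ) - f (γ 0)) (φ₁ τ) τ := (hφd τ).sub_const (f (γ 0))
      have hB : HasDerivAt (fun τ : ℝ ↦ τ * φ₁ 0) (φ₁ 0) τ := by
        simpa using (hasDerivAt_id τ).mul_const (φ₁ 0)
      have hC : HasDerivAt (fun τ : ℝ ↦ (1 / 2) * τ ^ 2 * φ₂ 0) (τ * φ₂ 0) τ :=
        (((hasDerivAt_pow 2 τ).const_mul (1 / 2)).mul_const (φ₂ 0)).congr_deriv (by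
          simp only [Nat.cast_ofNat, Nat.add_one_sub_one, pow_one]; ring)
      exact ((hA.fun_sub hB).fun_sub hC).hasDerivWithinAt
    have h := norm_image_sub_le_of_norm_deriv_le_segment' hder (C := L * S ^ 3) (fun τ hτ ↦ by
      rw [Real.norm_eq_abs]
      refine (hψ₁ τ (Ico_subset_Icc_self hτ)).trans ?_
      exact mul_le_of_le_one_right (mul_nonneg hL (pow_nonneg hS0 3)) hτ.2.le)
    have := h 1 (right_mem_Icc.2 zero_le_one)
    simpa [Real.norm_eq_abs] using this
  -- rewrite in terms of `f`, `g`, `h`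
  have e0 : γ 0 = y := by simp [hγ]
  have e1 : γ 1 = y + Δ := by simp [hγ]
  have eφ₁ : φ₁ 0 = ∑ i, fderiv ℝ f y (Pi.single i 1) * Δ i := by
    rw [hφ₁]; simp only [e0]; exact sum_congr rfl fun i _ ↦ by rw [hg]; ring
  have eφ₂ : φ₂ 0 = ∑ i, ∑ j, fderiv ℝ (fun z ↦ fderiv ℝ f z (Pi.single i 1)) y (Pi.single j 1) *
      (Δ i * Δ j) := by
    rw [hφ₂]; simp only [e0]
    refine sum_congr rfl fun i _ ↦ ?_
    rw [mul_sum]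
    exact sum_congr rfl fun j _ ↦ by rw [hh, hg]; ring
  rw [e0, e1, eφ₁, eφ₂] at hψ
  exact hψ

/-- **Taylor data of a `C³` function with compact support.**  For `f : (ι → ℝ) → ℝ` of class `C³`
with compact support there are a constant `Cf ≥ 0` and the partial derivatives `gᵢ = ∂ᵢf`,
`hᵢⱼ = ∂ⱼ∂ᵢf` (continuous) such that `|f|, |gᵢ|, |hᵢⱼ| ≤ Cf`, `gᵢ, hᵢⱼ` are `Cf`-Lipschitz for the
`ℓ¹` distance, and `|f(y+Δ) - f(y) - ∑ gᵢ(y)Δᵢ - ½∑ hᵢⱼ(y)ΔᵢΔⱼ| ≤ Cf ∑ |Δᵢ|³` — the test-function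
interface of `dynkin_expectation`. [folklore] -/
theorem taylorData_of_contDiff [DecidableEq ι] {f : (ι → ℝ) → ℝ} (hf : ContDiff ℝ 3 f)
    (hfc : HasCompactSupport f) :
    ∃ Cf : ℝ, 0 ≤ Cf ∧ (∀ y, |f y| ≤ Cf) ∧
      (∀ i, Continuous fun y ↦ fderiv ℝ f y (Pi.single i 1)) ∧
      (∀ i j, Continuous fun y ↦ fderiv ℝ (fun z ↦ fderiv ℝ f z (Pi.single i 1)) y (Pi.single j 1)) ∧
      (∀ i y, |fderiv ℝ f y (Pi.single i 1)| ≤ Cf) ∧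
      (∀ i j y, |fderiv ℝ (fun z ↦ fderiv ℝ f z (Pi.single i 1)) y (Pi.single j 1)| ≤ Cf) ∧
      (∀ i y y', |fderiv ℝ f y (Pi.single i 1) - fderiv ℝ f y' (Pi.single i 1)| ≤ Cf * ∑ l, |y l - y' l|) ∧
      (∀ i j y y', |fderiv ℝ (fun z ↦ fderiv ℝ f z (Pi.single i 1)) y (Pi.single j 1) -
        fderiv ℝ (fun z ↦ fderiv ℝ f z (Pi.single i 1)) y' (Pi.single j 1)| ≤ Cf * ∑ l, |y l - y' l|) ∧
      (∀ y Δ : ι → ℝ, |f (y + Δ) - f y - ∑ i, fderiv ℝ f y (Pi.single i 1) * Δ i -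
        (1 / 2) * ∑ i, ∑ j, fderiv ℝ (fun z ↦ fderiv ℝ f z (Pi.single i 1)) y (Pi.single j 1) *
          (Δ i * Δ j)| ≤ Cf * ∑ i, |Δ i| ^ 3) := by
  set g : ι → (ι → ℝ) → ℝ := fun i z ↦ fderiv ℝ f z (Pi.single i 1) with hg
  set h : ι → ι → (ι → ℝ) → ℝ := fun i j z ↦ fderiv ℝ (g i) z (Pi.single j 1) with hh
  have hf2 : ContDiff ℝ 2 f := hf.of_le (by norm_num)
  have hg_cd : ∀ i, ContDiff ℝ 2 (g i) := fun i ↦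
    (hf.fderiv_right (by norm_num)).clm_apply contDiff_const
  have hh_cd : ∀ i j, ContDiff ℝ 1 (h i j) := fun i j ↦
    ((hg_cd i).fderiv_right (by norm_num)).clm_apply contDiff_const
  have hg_cs : ∀ i, HasCompactSupport (g i) := fun i ↦ hfc.fderiv_apply (𝕜 := ℝ) (Pi.single i 1)
  have hh_cs : ∀ i j, HasCompactSupport (h i j) := fun i j ↦ (hg_cs i).fderiv_apply (𝕜 := ℝ) (Pi.single j 1)
  have hgc : ∀ i, Continuous (g i) := fun i ↦ (hg_cd i).continuous
  have hhc : ∀ i j, Continuous (h i j) := fun i j ↦ (hh_cd i j).continuous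
  -- bounds
  obtain ⟨C0, hC0⟩ := hfc.exists_bound_of_continuous hf.continuous
  choose Cg hCg using fun i ↦ (hg_cs i).exists_bound_of_continuous (hgc i)
  choose Ch hCh using fun i j ↦ (hh_cs i j).exists_bound_of_continuous (hhc i j)
  -- Lipschitz constants
  choose Kg hKg using fun i ↦ ContDiff.lipschitzWith_of_hasCompactSupport (hg_cs i) (hg_cd i) (by norm_num)
  choose Kh hKh using fun i j ↦ ContDiff.lipschitzWith_of_hasCompactSupport (hh_cs i j) (hh_cd i j)
    (by norm_num)
  -- one constant for everything
  set Lh : ℝ := ∑ i, ∑ j, (Kh i j : ℝ) with hLh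
  have hLh0 : 0 ≤ Lh := sum_nonneg fun i _ ↦ sum_nonneg fun j _ ↦ (Kh i j).2
  set Cf : ℝ := |C0| + ∑ i, |Cg i| + ∑ i, ∑ j, |Ch i j| + ∑ i, (Kg i : ℝ) + Lh +
    Lh * (Fintype.card ι : ℝ) ^ 2 with hCf
  have hKg0 : 0 ≤ ∑ i, (Kg i : ℝ) := sum_nonneg fun i _ ↦ (Kg i).2
  have hsg0 : 0 ≤ ∑ i, |Cg i| := sum_nonneg fun i _ ↦ abs_nonneg _
  have hsh0 : 0 ≤ ∑ i, ∑ j, |Ch i j| := sum_nonneg fun i _ ↦ sum_nonneg fun j _ ↦ abs_nonneg _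
  have hLn0 : 0 ≤ Lh * (Fintype.card ι : ℝ) ^ 2 := by positivity
  have hCf0 : 0 ≤ Cf := by rw [hCf]; positivity
  -- individual ≤ Cf
  have hC0le : |C0| ≤ Cf := by rw [hCf]; linarith [abs_nonneg C0]
  have hCgle : ∀ i, |Cg i| ≤ Cf := fun i ↦ by
    have := single_le_sum (f := fun i ↦ |Cg i|) (fun i _ ↦ abs_nonneg _) (mem_univ i)
    rw [hCf]; linarith [abs_nonneg C0]
  have hChle : ∀ i j, |Ch i j| ≤ Cf := fun i j ↦ by
    have h1 := single_le_sum (f := fun j ↦ |Ch i j|) (fun j _ ↦ abs_nonneg _) (mem_univ j)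
    have h2 := single_le_sum (f := fun i ↦ ∑ j, |Ch i j|) (fun i _ ↦ sum_nonneg fun j _ ↦ abs_nonneg _)
      (mem_univ i)
    rw [hCf]; linarith [abs_nonneg C0]
  have hKgle : ∀ i, (Kg i : ℝ) ≤ Cf := fun i ↦ by
    have := single_le_sum (f := fun i ↦ (Kg i : ℝ)) (fun i _ ↦ (Kg i).2) (mem_univ i)
    rw [hCf]; linarith [abs_nonneg C0]
  have hKhle : ∀ i j, (Kh i j : ℝ) ≤ Lh := fun i j ↦ by
    have h1 := single_le_sum (f := fun j ↦ (Kh i j : ℝ)) (fun j _ ↦ (Kh i j).2) (mem_univ j)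
    have h2 := single_le_sum (f := fun i ↦ ∑ j, (Kh i j : ℝ)) (fun i _ ↦ sum_nonneg fun j _ ↦ (Kh i j).2)
      (mem_univ i)
    exact h1.trans h2
  have hLhle : Lh ≤ Cf := by rw [hCf]; linarith [abs_nonneg C0]
  -- Lipschitz in the `ℓ¹` form
  have hlip : ∀ {φ : (ι → ℝ) → ℝ} {K : NNReal}, LipschitzWith K φ → ∀ y y',
      |φ y - φ y'| ≤ (K : ℝ) * ∑ l, |y l - y' l| := by
    intro φ K hK y y'
    have h1 := hK.dist_le_mul y y'
    rw [Real.dist_eq, dist_eq_norm] at h1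
    exact h1.trans (mul_le_mul_of_nonneg_left (pi_norm_le_sum_abs _) K.2)
  have hgL : ∀ i y y', |g i y - g i y'| ≤ Cf * ∑ l, |y l - y' l| := fun i y y' ↦
    (hlip (hKg i) y y').trans (mul_le_mul_of_nonneg_right (hKgle i) (sum_nonneg fun l _ ↦ abs_nonneg _))
  have hhL' : ∀ i j y y', |h i j y - h i j y'| ≤ Lh * ∑ l, |y l - y' l| := fun i j y y' ↦
    (hlip (hKh i j) y y').trans (mul_le_mul_of_nonneg_right (hKhle i j) (sum_nonneg fun l _ ↦ abs_nonneg _))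
  have hhL : ∀ i j y y', |h i j y - h i j y'| ≤ Cf * ∑ l, |y l - y' l| := fun i j y y' ↦
    (hhL' i j y y').trans (mul_le_mul_of_nonneg_right hLhle (sum_nonneg fun l _ ↦ abs_nonneg _))
  refine ⟨Cf, hCf0, fun y ↦ ?_, hgc, hhc, fun i y ↦ ?_, fun i j y ↦ ?_, hgL, hhL, fun y Δ ↦ ?_⟩
  · exact ((Real.norm_eq_abs _).symm.le.trans (hC0 y)).trans ((le_abs_self C0).trans hC0le)
  · exact ((Real.norm_eq_abs _).symm.le.trans (hCg i y)).trans ((le_abs_self _).trans (hCgle i))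
  · exact ((Real.norm_eq_abs _).symm.le.trans (hCh i j y)).trans ((le_abs_self _).trans (hChle i j))
  · have hT := abs_taylor_two_sub_le_of_lipschitz hf2 hLh0 hhL' y Δ
    refine hT.trans ?_
    calc Lh * (∑ i, |Δ i|) ^ 3 ≤ Lh * ((Fintype.card ι : ℝ) ^ 2 * ∑ i, |Δ i| ^ 3) :=
          mul_le_mul_of_nonneg_left (pow_three_sum_le (fun i ↦ |Δ i|) fun i ↦ abs_nonneg _) hLh0
      _ = Lh * (Fintype.card ι : ℝ) ^ 2 * ∑ i, |Δ i| ^ 3 := by ring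
      _ ≤ Cf * ∑ i, |Δ i| ^ 3 := by
          refine mul_le_mul_of_nonneg_right ?_ (sum_nonneg fun i _ ↦ pow_nonneg (abs_nonneg _) 3)
          rw [hCf]; linarith [abs_nonneg C0]

end Calculus

end Summit.QuantumFields.YangMills.Theorems.ColdStartUniversality

end
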